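import Literature.AlgebraicGeometry.Frobenioids.NumberFieldLocalizationsGlue
import Literature.AlgebraicGeometry.Frobenioids.BCatOrbitsAnyTopology
import HarnessLib

/-!
# Frobenioids II, Proposition 1.5 (i), base case, for an ARBITRARY topology on `G`:
# `P₀` is reconstructed from `E₀` by inverting the `P₀`-isomorphisms

Mochizuki, *The geometry of Frobenioids II: poly-Frobenioids*, Kyushu J. Math. **62** (2008)
401–460, §1, Example 1.4 (ii) p. 13 and Proposition 1.5 (i) p. 13 with its proof p. 14
[cite: MochizukiFrdII2008, Prop. 1.5 (i) pp.13-14]: "The bijection of assertion (i) follows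
immediately from the definitions and the easily verified observation that such a bijection exists
when `P → P₀` is the identity functor on `P₀`."

PROOF-ONLY file (no definitions).  The statement file `NumberFieldLocalizationsGlue.lean` types this
observation as the named obligation `NFLocCat.ToP₀HomReconstruction G D :=
NFLoc.HomReconstruction (toP₀ G D)` over a group `G` carrying an ARBITRARY `TopologicalSpace`
structure (no compatibility with the group law is among the binders) and a subgroup `D` (the paper's
`G = Gal(F̃/F)`, `D = D_v`).  The landed witness `NFLocCat.toP₀HomReconstruction_holds`
(`NumberFieldLocalizationApplication.lean`, via `NumberFieldLocalizationReconstruction.lean`) assumes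
`[IsTopologicalGroup G]`, because its test objects are the COSET objects `G/U`, `D/(U ∩ D)` of
`BCatOrbits.exists_coset_obj`, whose continuity needs translations of `G` to be homeomorphisms; so it
does not reach the universal closure of the typed fact (abc-iut FACT-LIST row F-1177, R7 type-audit
"needs `[IsTopologicalGroup G]`").  Here the same argument is run over the any-topology toolkit
`BCatOrbitsAnyTopology.lean`: the test object attached to points `q ∈ Q`, `q' ∈ Q'` of objects of
`B(G)` is `(D·(q, q') ⊆ (Q × Q')|_D, G·(q, q') ⊆ Q × Q', inclusion)` (`BCat.exists_pairOrbit_obj` in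
`B(D)` and in `B(G)`), with stabilisers `Stab_D(q) ∩ Stab_D(q')`, `Stab_G(q) ∩ Stab_G(q')` and the same
mapping properties as the coset objects — continuity of these needs nothing.  With it:

* surjectivity: an arrow `g : P₁ → P₂` of `P₀` between the projections of `(P₁, Q₁, ι₁)`,
  `(P₂, Q₂, ι₂)` is presented by the test object for `q = ι₁ p`, `q' = ι₂ g(p)`, whose `P`-component
  maps isomorphically onto `P₁`;
* injectivity: two presentations of `g` are refined by the test object for `q = ι_Z z`,
  `q' = ι_{Z'} z'`, `z`, `z'` the points over a base point of `P₁`.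

Closing declaration: `NFLocCat.ToP₀HomReconstruction_closure : ∀ G [Group G] [TopologicalSpace G] D,
ToP₀HomReconstruction G D` — the universal closure of the fact EXACTLY AS TYPED.  Nothing here bears
on [IUTchIII]; no side is taken on its Corollary 3.12.
-/

namespace Literature.AlgebraicGeometry.Frobenioids

open CategoryTheory
open scoped FintypeCatDiscrete

universe u

namespace NFLocCat

variable {G : Type u} [Group G] [TopologicalSpace G] (D : Subgroup G)

/-! ### Points and structure arrows of the objects of `E₀` (any topology on `G`) -/

/-- An object `(P, Q, ι)` of `E₀` has a point of `P`. [cite: MochizukiFrdII2008, Ex. 1.4 (i) p.12] -/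
private theorem nonempty_left₀ (T : ECat G D) : Nonempty T.obj.left.obj.obj.V :=
  BCat.nonempty_of_isNonemptyObj _ T.obj.left.property.1

/-- The structure arrow `ι : P → Q|_D` is injective on points (a monomorphism of `B(D)`, for any
topology on `D`). [cite: MochizukiFrdII2008, Ex. 1.4 (i) p.12] -/
private theorem hom_injective₀ (T : ECat G D) : Function.Injective T.obj.hom.hom.hom := by
  haveI : Mono T.obj.hom := T.property
  exact BCat.injective_of_mono' T.obj.hom

/-- A point `p` of `P` is fixed by `d ∈ D` iff `ι(p)` is (`ι` is injective and equivariant).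
[cite: MochizukiFrdII2008, Ex. 1.4 (i) p.12] -/
private theorem smul_eq_iff₀ (T : ECat G D) (p : T.obj.left.obj.obj.V) (d : D) :
    d • p = p ↔
      (d : G) ∈ MulAction.stabilizer G (α := T.obj.right.obj.obj.V) (T.obj.hom.hom.hom p) := by
  have e := BCat.hom_smul (X := T.obj.left.obj) (Y := (res G D).obj T.obj.right.obj) T.obj.hom d p
  rw [MulAction.mem_stabilizer_iff]
  constructor
  · intro h
    exact (e.symm.trans (congrArg _ h) : _)
  · intro h
    apply hom_injective₀ D T
    exact e.trans h

/-- Two morphisms of `E₀` with the same `P`-component are equal (the `Q`-components agree at the image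
of a point of `P`, and `Q` is a single orbit — for any topology on `G`).
[cite: MochizukiFrdII2008, Ex. 1.4 (ii) p.13] -/
private theorem hom_eq_of_left_eq₀ {T T' : ECat G D} {f f' : T ⟶ T'}
    (h : f.hom.left = f'.hom.left) : f = f' := by
  obtain ⟨p⟩ := nonempty_left₀ D T
  apply ObjectProperty.hom_ext
  apply Comma.hom_ext _ _ h
  apply ObjectProperty.hom_ext
  apply BCat.hom_eq_of_apply_eq' T.obj.right.property (T.obj.hom.hom.hom p)
  have w₁ := congrArg (fun k => k.hom.hom p) f.hom.w
  have w₂ := congrArg (fun k => k.hom.hom p) f'.hom.w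
  dsimp only at w₁ w₂
  change T'.obj.hom.hom.hom (f.hom.left.hom.hom.hom p) = f.hom.right.hom.hom.hom (T.obj.hom.hom.hom p)
    at w₁
  change T'.obj.hom.hom.hom (f'.hom.left.hom.hom.hom p) = f'.hom.right.hom.hom.hom (T.obj.hom.hom.hom p)
    at w₂
  rw [h] at w₁
  exact w₁.symm.trans w₂

/-! ### The test object `(D·(q, q'), G·(q, q'))` with its stabilisers -/

/-- The stabiliser in `D` of a point of a restricted object `Q|_D` is the trace on `D` of its stabiliser
in `G`. [cite: MochizukiFrdII2008, Ex. 1.4 (i) p.12] -/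
private theorem stabilizer_res (Q : BCat G) (q : Q.obj.V) :
    MulAction.stabilizer D (α := ((res G D).obj Q).obj.V) q =
      (MulAction.stabilizer G q).subgroupOf D := by
  ext d
  rw [Subgroup.mem_subgroupOf, MulAction.mem_stabilizer_iff, MulAction.mem_stabilizer_iff]
  exact Iff.rfl

/-- For points `q ∈ Q`, `q' ∈ Q'` of objects of `B(G)` — ANY topology on `G` — the object
`T₄ = (D·(q, q'), G·(q, q'), inclusion)` of `E₀` (orbits of the pair `(q, q')` under `D` in `(Q × Q')|_D`
and under `G` in `Q × Q'`) with base points `p₄ ↦ q₄` of stabilisers `(Stab(q) ∩ Stab(q')) ∩ D`,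
`Stab(q) ∩ Stab(q')`: both components are single orbits, with the mapping properties of the pair-orbit
objects (`BCat.exists_pairOrbit_obj`).  Replaces the coset test object `(D/(U ∩ D), G/U)`.
[cite: MochizukiFrdII2008, Ex. 1.4 (ii) p.13] -/
private theorem exists_testObj₀ (Q Q' : BCat G) (q : Q.obj.V) (q' : Q'.obj.V) :
    ∃ (T₄ : ECat G D) (p₄ : T₄.obj.left.obj.obj.V) (q₄ : T₄.obj.right.obj.obj.V),
      T₄.obj.hom.hom.hom p₄ = q₄ ∧
      (∀ p : T₄.obj.left.obj.obj.V, ∃ d : D, d • p₄ = p) ∧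
      (∀ z : T₄.obj.right.obj.obj.V, ∃ g : G, g • q₄ = z) ∧
      MulAction.stabilizer D p₄ =
        (MulAction.stabilizer G q ⊓ MulAction.stabilizer G q').subgroupOf D ∧
      (∀ (Y : BCat G) (y : Y.obj.V),
          MulAction.stabilizer G q ⊓ MulAction.stabilizer G q' ≤ MulAction.stabilizer G y →
          ∃ b : T₄.obj.right.obj ⟶ Y, b.hom.hom q₄ = y) ∧
      (∀ (X : BCat D) (x : X.obj.V),
          (∀ d : D, (d : G) ∈ MulAction.stabilizer G q ⊓ MulAction.stabilizer G q' → d • x = x) →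
          ∃ a : T₄.obj.left.obj ⟶ X, a.hom.hom p₄ = x) := by
  obtain ⟨Q₄, q₄, hq₄, htrQ, hmapQ⟩ := BCat.exists_pairOrbit_obj Q Q' q q'
  obtain ⟨P₄, p₄, hp₄, htrP, hmapP⟩ :=
    BCat.exists_pairOrbit_obj (G := D) ((res G D).obj Q) ((res G D).obj Q') q q'
  have hp₄' : MulAction.stabilizer D p₄ =
      (MulAction.stabilizer G q ⊓ MulAction.stabilizer G q').subgroupOf D := by
    rw [hp₄, stabilizer_res D Q q, stabilizer_res D Q' q']
    ext d
    simp only [Subgroup.mem_inf, Subgroup.mem_subgroupOf]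
  have hmapP' : ∀ (X : BCat D) (x : X.obj.V),
      (∀ d : D, (d : G) ∈ MulAction.stabilizer G q ⊓ MulAction.stabilizer G q' → d • x = x) →
      ∃ a : P₄ ⟶ X, a.hom.hom p₄ = x := fun X x hx =>
    hmapP X x fun d hd => by
      have hd' : d ∈ MulAction.stabilizer D p₄ := by
        rw [hp₄]
        exact hd
      rw [hp₄', Subgroup.mem_subgroupOf] at hd'
      exact MulAction.mem_stabilizer_iff.mpr (hx d hd')
  -- `ι₄ : P₄ → Q₄|_D`, `p₄ ↦ q₄`
  obtain ⟨ι₄, hι₄⟩ := hmapP' ((res G D).obj Q₄) q₄ fun d hd => by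
    rw [← hq₄] at hd
    exact (MulAction.mem_stabilizer_iff.mp hd : _)
  have hι₄m : Mono ι₄ := BCat.mono_of_injective ι₄ (BCat.injective_of_stabilizer_le ι₄ p₄ htrP
    fun d hd => by
      rw [hp₄', Subgroup.mem_subgroupOf, ← hq₄]
      rw [hι₄] at hd
      exact MulAction.mem_stabilizer_iff.mpr (MulAction.mem_stabilizer_iff.mp hd))
  let T₄ : ECat G D :=
    ⟨⟨⟨P₄, BCat.isConnectedObj_of_transitive' P₄ p₄ htrP⟩,
      ⟨Q₄, BCat.isConnectedObj_of_transitive' Q₄ q₄ htrQ⟩, ι₄⟩, hι₄m⟩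
  exact ⟨T₄, p₄, q₄, hι₄, htrP, htrQ, hp₄', fun Y y hy => hmapQ Y y hy, hmapP'⟩

/-- A morphism `T₄ ⟶ T''` of `E₀` from components that are compatible at the base point of the single
orbit `P₄`. [cite: MochizukiFrdII2008, Ex. 1.4 (ii) p.13] -/
private theorem exists_hom_of_apply₀ {T₄ T'' : ECat G D} (p₄ : T₄.obj.left.obj.obj.V)
    (q₄ : T₄.obj.right.obj.obj.V) (hq : T₄.obj.hom.hom.hom p₄ = q₄)
    (htrP : ∀ p : T₄.obj.left.obj.obj.V, ∃ d : D, d • p₄ = p)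
    (a : T₄.obj.left.obj ⟶ T''.obj.left.obj) (b : T₄.obj.right.obj ⟶ T''.obj.right.obj)
    (hab : T''.obj.hom.hom.hom (a.hom.hom p₄) = b.hom.hom q₄) :
    ∃ u : T₄ ⟶ T'', u.hom.left = ObjectProperty.homMk a ∧ u.hom.right = ObjectProperty.homMk b :=
  ⟨ObjectProperty.homMk
    { left := ObjectProperty.homMk a
      right := ObjectProperty.homMk b
      w := BCat.hom_eq_of_apply_eq_of_transitive p₄ htrP (by
        change T''.obj.hom.hom.hom (a.hom.hom p₄) = b.hom.hom (T₄.obj.hom.hom.hom p₄)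
        rw [hq]
        exact hab) }, rfl, rfl⟩

/-! ### Proposition 1.5 (i) for the identity functor of `P₀`: surjectivity (any topology on `G`) -/

/-- Every arrow `g : P₁ → P₂` of `P₀` between projections of objects `(P₁, Q₁, ι₁)`, `(P₂, Q₂, ι₂)` of
`E₀` is presented as `(π s)⁻¹ ≫ π f` for a `P₀`-isomorphism `s : Z → (P₁, Q₁, ι₁)` and an arrow
`f : Z → (P₂, Q₂, ι₂)` of `E₀`, `Z = (D·(q, q'), G·(q, q'))` with `q = ι₁ p`, `q' = ι₂ g(p)` — for an
ARBITRARY topology on `G`. [cite: MochizukiFrdII2008, Prop. 1.5 (i) p.13] -/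
theorem homReconstruction_toP₀_surj' (X Y : ECat G D)
    (g : (toP₀ G D).obj X ⟶ (toP₀ G D).obj Y) :
    ∃ (Z : ECat G D) (s : Z ⟶ X) (f : Z ⟶ Y),
      NFLoc.IsProjIso (toP₀ G D) s ∧ (toP₀ G D).map s ≫ g = (toP₀ G D).map f := by
  change X.obj.left ⟶ Y.obj.left at g
  obtain ⟨p⟩ := nonempty_left₀ D X
  obtain ⟨T₄, p₄, q₄, hι, htrP, htrQ, hp₄, hmapQ, hmapP⟩ := exists_testObj₀ D X.obj.right.obj
    Y.obj.right.obj (X.obj.hom.hom.hom p) (Y.obj.hom.hom.hom (g.hom.hom.hom p))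
  -- `d ∈ Stab(ι₁ p)` fixes `p`; `d ∈ Stab(ι₂ g(p))` fixes `g(p)`
  obtain ⟨a₁, ha₁⟩ := hmapP X.obj.left.obj p fun d hd =>
    (smul_eq_iff₀ D X p d).mpr (Subgroup.mem_inf.mp hd).1
  obtain ⟨b₁, hb₁⟩ := hmapQ X.obj.right.obj (X.obj.hom.hom.hom p) inf_le_left
  obtain ⟨a₂, ha₂⟩ := hmapP Y.obj.left.obj (g.hom.hom.hom p) fun d hd =>
    (smul_eq_iff₀ D Y _ d).mpr (Subgroup.mem_inf.mp hd).2
  obtain ⟨b₂, hb₂⟩ := hmapQ Y.obj.right.obj (Y.obj.hom.hom.hom (g.hom.hom.hom p)) inf_le_right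
  obtain ⟨s, hsl, hsr⟩ := exists_hom_of_apply₀ D p₄ q₄ hι htrP a₁ b₁ (by rw [ha₁, hb₁])
  obtain ⟨f, hfl, hfr⟩ := exists_hom_of_apply₀ D p₄ q₄ hι htrP a₂ b₂ (by rw [ha₂, hb₂])
  refine ⟨T₄, s, f, ?_, ?_⟩
  · -- `s` is a `P₀`-isomorphism: `a₁ : D·(q, q') → P₁` is bijective
    have hinj : Function.Injective a₁.hom.hom := by
      refine BCat.injective_of_stabilizer_le a₁ p₄ htrP fun d hd => ?_
      rw [ha₁, MulAction.mem_stabilizer_iff] at hd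
      rw [hp₄, Subgroup.mem_subgroupOf, Subgroup.mem_inf]
      refine ⟨(smul_eq_iff₀ D X p d).mp hd, (smul_eq_iff₀ D Y _ d).mp ?_⟩
      exact ((BCat.hom_smul g.hom d p).symm.trans (congrArg _ hd) : _)
    have hsurj : Function.Surjective a₁.hom.hom :=
      BCat.surjective_of_isConnectedObj' a₁ p₄ X.obj.left.property
    haveI : IsIso a₁ := BCat.isIso_of_bijective a₁ ⟨hinj, hsurj⟩
    change IsIso s.hom.left
    rw [hsl]
    exact (ObjectProperty.isIso_hom_iff _).mp (inferInstanceAs (IsIso a₁))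
  · change s.hom.left ≫ g = f.hom.left
    rw [hsl, hfl]
    apply ObjectProperty.hom_ext
    apply BCat.hom_eq_of_apply_eq_of_transitive p₄ htrP
    change g.hom.hom.hom (a₁.hom.hom p₄) = a₂.hom.hom p₄
    rw [ha₁, ha₂]

/-! ### Proposition 1.5 (i) for the identity functor of `P₀`: injectivity (any topology on `G`) -/

/-- Two presentations `(Z, s, f)`, `(Z', s', f')` of the same arrow of `P₀` admit a common refinement by
`P₀`-isomorphisms `W → Z`, `W → Z'`, `W = (D·(q, q'), G·(q, q'))` with `q = ι_Z z`, `q' = ι_{Z'} z'`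
for the points `z`, `z'` over a base point of `P₁` — for an ARBITRARY topology on `G`.
[cite: MochizukiFrdII2008, Prop. 1.5 (i) p.13] -/
theorem homReconstruction_toP₀_inj' {X Y Z Z' : ECat G D} (s : Z ⟶ X) (f : Z ⟶ Y)
    (s' : Z' ⟶ X) (f' : Z' ⟶ Y) (g : (toP₀ G D).obj X ⟶ (toP₀ G D).obj Y)
    (hs : NFLoc.IsProjIso (toP₀ G D) s) (hs' : NFLoc.IsProjIso (toP₀ G D) s')
    (hf : (toP₀ G D).map s ≫ g = (toP₀ G D).map f)
    (hf' : (toP₀ G D).map s' ≫ g = (toP₀ G D).map f') :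
    ∃ (W : ECat G D) (t : W ⟶ Z) (t' : W ⟶ Z'), NFLoc.IsProjIso (toP₀ G D) t ∧
      NFLoc.IsProjIso (toP₀ G D) t' ∧ t ≫ s = t' ≫ s' ∧ t ≫ f = t' ≫ f' := by
  change X.obj.left ⟶ Y.obj.left at g
  obtain ⟨p⟩ := nonempty_left₀ D X
  haveI : IsIso s.hom.left := hs
  haveI : IsIso s'.hom.left := hs'
  obtain ⟨z, hz⟩ := (BCat.bijective_of_isIso s.hom.left.hom).2 p
  obtain ⟨z', hz'⟩ := (BCat.bijective_of_isIso s'.hom.left.hom).2 p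
  have hf₁ : f.hom.left.hom.hom.hom z = g.hom.hom.hom p := by
    have e := congrArg (fun k => InducedCategory.Hom.hom k) hf
    have e' := congrArg (fun k => k.hom.hom z) e
    change g.hom.hom.hom (s.hom.left.hom.hom.hom z) = f.hom.left.hom.hom.hom z at e'
    rw [hz] at e'
    exact e'.symm
  have hf₁' : f'.hom.left.hom.hom.hom z' = g.hom.hom.hom p := by
    have e := congrArg (fun k => InducedCategory.Hom.hom k) hf'
    have e' := congrArg (fun k => k.hom.hom z') e
    change g.hom.hom.hom (s'.hom.left.hom.hom.hom z') = f'.hom.left.hom.hom.hom z' at e'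
    rw [hz'] at e'
    exact e'.symm
  -- `Stab_D(z) = Stab_D(p) = Stab_D(z')` along the equivariant bijections `s`, `s'`
  have hsz : ∀ d : D, s.hom.left.hom.hom.hom (d • z) = d • p := fun d =>
    (BCat.hom_smul s.hom.left.hom d z).trans (congrArg _ hz)
  have hsz' : ∀ d : D, s'.hom.left.hom.hom.hom (d • z') = d • p := fun d =>
    (BCat.hom_smul s'.hom.left.hom d z').trans (congrArg _ hz')
  have hzz' : ∀ d : D, d • z = z → d • z' = z' := fun d hd => by
    apply (BCat.bijective_of_isIso s'.hom.left.hom).1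
    have e : d • p = p := ((hsz d).symm.trans (congrArg _ hd)).trans hz
    exact ((hsz' d).trans e).trans hz'.symm
  have hz'z : ∀ d : D, d • z' = z' → d • z = z := fun d hd => by
    apply (BCat.bijective_of_isIso s.hom.left.hom).1
    have e : d • p = p := ((hsz' d).symm.trans (congrArg _ hd)).trans hz'
    exact ((hsz d).trans e).trans hz.symm
  obtain ⟨T₄, p₄, q₄, hι, htrP, htrQ, hp₄, hmapQ, hmapP⟩ := exists_testObj₀ D Z.obj.right.obj
    Z'.obj.right.obj (Z.obj.hom.hom.hom z) (Z'.obj.hom.hom.hom z')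
  obtain ⟨a, ha⟩ := hmapP Z.obj.left.obj z fun d hd =>
    (smul_eq_iff₀ D Z z d).mpr (Subgroup.mem_inf.mp hd).1
  obtain ⟨b, hb⟩ := hmapQ Z.obj.right.obj (Z.obj.hom.hom.hom z) inf_le_left
  obtain ⟨a', ha'⟩ := hmapP Z'.obj.left.obj z' fun d hd =>
    (smul_eq_iff₀ D Z' z' d).mpr (Subgroup.mem_inf.mp hd).2
  obtain ⟨b', hb'⟩ := hmapQ Z'.obj.right.obj (Z'.obj.hom.hom.hom z') inf_le_right
  obtain ⟨t, htl, htr⟩ := exists_hom_of_apply₀ D p₄ q₄ hι htrP a b (by rw [ha, hb])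
  obtain ⟨t', ht'l, ht'r⟩ := exists_hom_of_apply₀ D p₄ q₄ hι htrP a' b' (by rw [ha', hb'])
  have hmem : ∀ d : D, d • z = z →
      d ∈ (MulAction.stabilizer G (α := Z.obj.right.obj.obj.V) (Z.obj.hom.hom.hom z) ⊓
        MulAction.stabilizer G (α := Z'.obj.right.obj.obj.V) (Z'.obj.hom.hom.hom z')).subgroupOf D :=
    fun d hd => by
      rw [Subgroup.mem_subgroupOf, Subgroup.mem_inf]
      exact ⟨(smul_eq_iff₀ D Z z d).mp hd, (smul_eq_iff₀ D Z' z' d).mp (hzz' d hd)⟩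
  have isoOf : ∀ {T'' : ECat G D} (c : T₄.obj.left.obj ⟶ T''.obj.left.obj)
      (w : T''.obj.left.obj.obj.V),
      c.hom.hom p₄ = w → (∀ d : D, d • w = w → d • z = z) → IsIso c := fun {T''} c w hc hw => by
    have hinj : Function.Injective c.hom.hom := by
      refine BCat.injective_of_stabilizer_le c p₄ htrP fun d hd => ?_
      rw [hc, MulAction.mem_stabilizer_iff] at hd
      rw [hp₄]
      exact hmem d (hw d hd)
    have hsurj : Function.Surjective c.hom.hom :=
      BCat.surjective_of_isConnectedObj' c p₄ T''.obj.left.property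
    exact BCat.isIso_of_bijective c ⟨hinj, hsurj⟩
  refine ⟨T₄, t, t', ?_, ?_, ?_, ?_⟩
  · change IsIso t.hom.left
    rw [htl]
    haveI := isoOf a z ha fun d hd => hd
    exact (ObjectProperty.isIso_hom_iff _).mp (inferInstanceAs (IsIso a))
  · change IsIso t'.hom.left
    rw [ht'l]
    haveI := isoOf a' z' ha' hz'z
    exact (ObjectProperty.isIso_hom_iff _).mp (inferInstanceAs (IsIso a'))
  · apply hom_eq_of_left_eq₀ D
    change t.hom.left ≫ s.hom.left = t'.hom.left ≫ s'.hom.left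
    rw [htl, ht'l]
    apply ObjectProperty.hom_ext
    apply BCat.hom_eq_of_apply_eq_of_transitive p₄ htrP
    change s.hom.left.hom.hom.hom (a.hom.hom p₄) = s'.hom.left.hom.hom.hom (a'.hom.hom p₄)
    rw [ha, ha', hz, hz']
  · apply hom_eq_of_left_eq₀ D
    change t.hom.left ≫ f.hom.left = t'.hom.left ≫ f'.hom.left
    rw [htl, ht'l]
    apply ObjectProperty.hom_ext
    apply BCat.hom_eq_of_apply_eq_of_transitive p₄ htrP
    change f.hom.left.hom.hom.hom (a.hom.hom p₄) = f'.hom.left.hom.hom.hom (a'.hom.hom p₄)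
    rw [ha, ha', hf₁, hf₁']

/-! ### Proposition 1.5 (i), base case: the reconstruction bijection for `E₀ → P₀` (any topology) -/

variable (G) in
/-- **Proposition 1.5 (i)**, base case (FrdII pp. 13–14: "the easily verified observation that such a
bijection exists when `P → P₀` is the identity functor on `P₀`"): `P₀ = B(D)⁰` is reconstructed from
`E₀` by inverting the `P₀`-isomorphisms — `NFLoc.HomReconstruction (toP₀ G D)` for EVERY group `G`
with an ARBITRARY topology and every subgroup `D` (the printed case is `G = Gal(F̃/F)` profinite).
[cite: MochizukiFrdII2008, Prop. 1.5 (i) p.13] -/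
theorem homReconstruction_toP₀' : NFLoc.HomReconstruction (toP₀ G D) :=
  ⟨fun X Y g => homReconstruction_toP₀_surj' D X Y g,
    fun s f s' f' g hs hs' hf hf' => homReconstruction_toP₀_inj' D s f s' f' g hs hs' hf hf'⟩

/-- The typed obligation `NFLocCat.ToP₀HomReconstruction` ([FrdII] Prop. 1.5 (i) input: hom
reconstruction for `E₀ → P₀`; abc-iut FACT-LIST F-1177) holds UNCONDITIONALLY: this is its universal
closure exactly as typed — `G` any group with any topology, `D` any subgroup, no `[IsTopologicalGroup G]`
(the landed `toP₀HomReconstruction_holds` carries that extra instance binder).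
[cite: MochizukiFrdII2008, Prop. 1.5 (i) p.13] -/
theorem ToP₀HomReconstruction_closure :
    ∀ (G : Type u) [Group G] [TopologicalSpace G] (D : Subgroup G), ToP₀HomReconstruction G D :=
  fun G _ _ D => homReconstruction_toP₀' G D

end NFLocCat

end Literature.AlgebraicGeometry.Frobenioids
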